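import Mathlib
import Summits.ValiantsHypothesis.ValiantsHypothesis.Theorems.KPlusLogSqLawTridiagonalRealStaticRatioTwoLaw

/-!
# Matchings of a path are counted by Fibonacci; the face laws in register language `F_{m+1} − 2`

The matchings of the path with edges `0, …, n−1` (sets of pairwise non-adjacent edges, the index set of the continuant / of the α register's
matching slope-sums) number `F_{n+2}` (`card_matchings_range : #matchings(range n) = Nat.fib (n + 2)`; split on the last edge).  Hence the
RATIO-TWO FACE LAW of `…TridiagonalRealStaticRatioTwoLaw.lean` reads `Z(D_m) + 2 ≤ F_{m+1}` (`card_posRoots_add_two_le_fib_of_slopes_g_2g`,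
`…_one_two`), one below the Descartes–Fibonacci count `F_{m+1} − 1` of `…TridiagonalRealStaticDescartesRow`, and so does the coincidence row
(`card_posRoots_add_two_le_fib_of_coincidence`).

HONEST FRAMING: bookkeeping; registers unchanged; nothing on `WeakLifting` windows, Conjecture B, `MatrixDescartes` (18050) or `VP ≠ VNP`.
Seat: prover val-sym-lift-p2 g18, `--supports stmt-ValiantsHypothesis-19561`.
-/

set_option linter.dupNamespace false
set_option autoImplicit false

namespace Summit.ValiantsHypothesis.ValiantsHypothesis.Theorems.KPlusLogSqLaw

namespace EdgeNormalForm

open Polynomial Finset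
open Summit.ValiantsHypothesis.ValiantsHypothesis.Theorems.KPlusLogSqLaw.StaticTridiagonalRealPotential (pathDet)

/-- **Matchings of the path with `n` edges number `F_{n+2}`.** [folklore] -/
theorem card_matchings_range : ∀ n : ℕ,
    ((range n).powerset.filter (fun M : Finset ℕ => ∀ j ∈ M, j + 1 ∉ M)).card = Nat.fib (n + 2)
  | 0 => by decide
  | 1 => by decide
  | (n + 2) => by
    have ih0 := card_matchings_range n
    have ih1 := card_matchings_range (n + 1)
    set P : Finset ℕ → Prop := fun M => ∀ j ∈ M, j + 1 ∉ M with hP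
    -- split the matchings of `range (n+2)` on the last edge `n+1`
    set T := (range (n + 2)).powerset.filter P with hT
    set A := T.filter (fun M => n + 1 ∉ M) with hA
    set B := T.filter (fun M => n + 1 ∈ M) with hB
    have hsplit : T.card = A.card + B.card := by
      rw [hA, hB, add_comm, Finset.card_filter_add_card_filter_not]
    -- `A` = matchings of `range (n+1)`
    have hAeq : A = (range (n + 1)).powerset.filter P := by
      ext M
      simp only [hA, hT, Finset.mem_filter, Finset.mem_powerset]
      constructor
      · rintro ⟨⟨hsub, hPM⟩, hn⟩
        refine ⟨fun j hj => ?_, hPM⟩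
        have := Finset.mem_range.mp (hsub hj)
        have hne : j ≠ n + 1 := fun e => hn (e ▸ hj)
        exact Finset.mem_range.mpr (by omega)
      · rintro ⟨hsub, hPM⟩
        refine ⟨⟨fun j hj => ?_, hPM⟩, fun h => ?_⟩
        · have := Finset.mem_range.mp (hsub hj); exact Finset.mem_range.mpr (by omega)
        · have := Finset.mem_range.mp (hsub h); omega
    -- `B` = `insert (n+1)` of the matchings of `range n`
    have hBeq : B = ((range n).powerset.filter P).image (fun M => insert (n + 1) M) := by
      ext M
      simp only [hB, hT, Finset.mem_filter, Finset.mem_powerset, Finset.mem_image]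
      constructor
      · rintro ⟨⟨hsub, hPM⟩, hn⟩
        refine ⟨M.erase (n + 1), ⟨fun j hj => ?_, fun j hj hj1 => ?_⟩, Finset.insert_erase hn⟩
        · obtain ⟨hjne, hjM⟩ := Finset.mem_erase.mp hj
          have hlt := Finset.mem_range.mp (hsub hjM)
          have hjn : j ≠ n := fun e => hPM j hjM (by rw [e]; exact hn)
          exact Finset.mem_range.mpr (by omega)
        · exact hPM j (Finset.mem_of_mem_erase hj) (Finset.mem_of_mem_erase hj1)
      · rintro ⟨M', ⟨hsub, hPM'⟩, rfl⟩
        refine ⟨⟨fun j hj => ?_, fun j hj hj1 => ?_⟩, Finset.mem_insert_self _ _⟩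
        · rcases Finset.mem_insert.mp hj with rfl | hj
          · exact Finset.mem_range.mpr (by omega)
          · have := Finset.mem_range.mp (hsub hj); exact Finset.mem_range.mpr (by omega)
        · rcases Finset.mem_insert.mp hj with rfl | hj
          · rcases Finset.mem_insert.mp hj1 with h | h
            · omega
            · have := Finset.mem_range.mp (hsub h); omega
          · rcases Finset.mem_insert.mp hj1 with h | h
            · have := Finset.mem_range.mp (hsub hj); omega
            · exact hPM' j hj h
    have hBcard : B.card = ((range n).powerset.filter P).card := by
      rw [hBeq]
      refine Finset.card_image_of_injOn fun M hM M' hM' h => ?_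
      have hnM : n + 1 ∉ M := fun hm => by
        have := Finset.mem_range.mp (Finset.mem_powerset.mp (Finset.mem_filter.mp (Finset.mem_coe.mp hM)).1 hm); omega
      have hnM' : n + 1 ∉ M' := fun hm => by
        have := Finset.mem_range.mp (Finset.mem_powerset.mp (Finset.mem_filter.mp (Finset.mem_coe.mp hM')).1 hm); omega
      have := congrArg (fun s => Finset.erase s (n + 1)) h
      simpa only [Finset.erase_insert hnM, Finset.erase_insert hnM'] using this
    rw [hsplit, hAeq, hBcard, ih1, ih0]
    have e : Nat.fib (n + 2 + 2) = Nat.fib (n + 2) + Nat.fib (n + 2 + 1) := Nat.fib_add_two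
    rw [e, show n + 1 + 2 = n + 2 + 1 from rfl]
    omega

variable (a : ℕ → ℝ) (d : ℕ → ℕ) (b : ℕ → ℝ) (f : ℕ → ℕ)

/-- the coincidence row in register language: two matchings with equal slope-sum ⇒ `Z(D_m) + 2 ≤ F_{m+1}` (`m ≥ 1`). [this work] -/
theorem card_posRoots_add_two_le_fib_of_coincidence (m : ℕ) (hm : 1 ≤ m) {N N' : Finset ℕ}
    (hN : N ∈ (range (m - 1)).powerset.filter (fun M : Finset ℕ => ∀ j ∈ M, j + 1 ∉ M))
    (hN' : N' ∈ (range (m - 1)).powerset.filter (fun M : Finset ℕ => ∀ j ∈ M, j + 1 ∉ M)) (hne : N ≠ N')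
    (hsum : ∑ j ∈ N, (2 * (f j : ℤ) - d j - d (j + 1)) = ∑ j ∈ N', (2 * (f j : ℤ) - d j - d (j + 1))) :
    ((pathDet a d b f m).roots.toFinset.filter (fun x => 0 < x)).card + 2 ≤ Nat.fib (m + 1) := by
  have h := card_posRoots_add_two_le_of_coincidence a d b f m hN hN' hne hsum
  rwa [card_matchings_range, show m - 1 + 2 = m + 1 by omega] at h

/-- **THE RATIO-TWO FACE LAW in register language**: `Z(D_m) + 2 ≤ F_{m+1}` (lattice form). [this work] -/
theorem card_posRoots_add_two_le_fib_of_slopes_g_2g (m k l g : ℕ) (ha : ∀ j, a j ≠ 0) (hb : ∀ j, b j ≠ 0)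
    (hg : 1 ≤ g) (hdiv : ∀ j, j + 2 ≤ m → (g : ℤ) ∣ 2 * (f j : ℤ) - d j - d (j + 1))
    (hkl : k + 2 ≤ l) (hlm : l + 2 ≤ m)
    (h12 : ((2 * (f k : ℤ) - d k - d (k + 1)).natAbs = g ∧ (2 * (f l : ℤ) - d l - d (l + 1)).natAbs = 2 * g) ∨
      ((2 * (f k : ℤ) - d k - d (k + 1)).natAbs = 2 * g ∧ (2 * (f l : ℤ) - d l - d (l + 1)).natAbs = g)) :
    ((pathDet a d b f m).roots.toFinset.filter (fun x => 0 < x)).card + 2 ≤ Nat.fib (m + 1) := by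
  have h := card_posRoots_add_two_le_card_matchings_of_slopes_g_2g a d b f m k l g ha hb hg hdiv hkl hlm h12
  rwa [card_matchings_range, show m - 1 + 2 = m + 1 by omega] at h

/-- **THE RATIO-TWO FACE LAW in register language**, primitive case: slopes `±1`, `±2` two or more links apart ⇒ `Z(D_m) ≤ F_{m+1} − 2`. [this work] -/
theorem card_posRoots_add_two_le_fib_of_slopes_one_two (m k l : ℕ) (ha : ∀ j, a j ≠ 0) (hb : ∀ j, b j ≠ 0)
    (hkl : k + 2 ≤ l) (hlm : l + 2 ≤ m)
    (h12 : ((2 * (f k : ℤ) - d k - d (k + 1)).natAbs = 1 ∧ (2 * (f l : ℤ) - d l - d (l + 1)).natAbs = 2) ∨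
      ((2 * (f k : ℤ) - d k - d (k + 1)).natAbs = 2 ∧ (2 * (f l : ℤ) - d l - d (l + 1)).natAbs = 1)) :
    ((pathDet a d b f m).roots.toFinset.filter (fun x => 0 < x)).card + 2 ≤ Nat.fib (m + 1) := by
  have h := card_posRoots_add_two_le_card_matchings_of_slopes_one_two a d b f m k l ha hb hkl hlm h12
  rwa [card_matchings_range, show m - 1 + 2 = m + 1 by omega] at h

end EdgeNormalForm

end Summit.ValiantsHypothesis.ValiantsHypothesis.Theorems.KPlusLogSqLaw
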